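import Summits.PneNP.PneNP.Theorems.Sd2BlMachineGlue
import Summits.PneNP.PneNP.Theorems.Sd2BlMachineConsts
import Summits.PneNP.PneNP.Theorems.Sd2BlMachineDictLabels
import Summits.PneNP.PneNP.Theorems.SfmBlExistsAux

/-!
# Sign-degree-2 engine, CLOSER part 2a: the closer's objects over the certificate legs
# (cell pnp-ideate, ROUND-18 item K1'' `SignDeg2Signing.SignDeg2SigningFP`, stage S3)

FRONTIER (range avoidance for sign-degree-≤2 local maps at linear stretch; restricted-model algorithmic
rung); nothing here bears on P vs NP.

Twin of `SfmBlSigningStep` (pure CAND) for the instantiated sign-degree-2 machine (`Sd2BlMachineConsts`: tables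
`F0k/F1k/F2k`, `ℓ = ellK k`, `t = tK k`, `L = gL t`) on the code of a `k`-local instance `I` all of whose tables have
sign-degree `≤ 2`, with the canonical certificate `cK I h := certOfIntCert I le_rfl (fun j => certOf k 2 (I.table j) (h j))`
(= `SignDeg2Signing.canonCert I h` by `rfl`) and prover-1's dictionary over `E = SignDeg2Legs.CLeg (cK I h)` (D1i/D2i/D2c:
`srcI`, `dstI`, `pI`, `plegI`, `V₁G/V₂G`, `mem_rlegs_iff_pI`, `mem_slegs_iff_subtypeI`).  For the machine's extraction
state `st = gExtract ℓ t plegs`: `nonempty_CLeg` / `one_le_gN` (`N ≥ 1` when `m ≥ 1`), `card_sides_le_pT0'` (every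
spot has `|V₁ s| + |V₂ s| ≤ t₀'`), the closer's objects `MpS` (part matrices), `WS` (connected sub-pairs of a spot),
`badS` (bad threshold `γ_b = √(34ℓ·4^t·2t)`), `meetS`, with the membership shapes `mem_WS_iff` / `mem_badS_iff` of
`legBound_of_pipeline`, and the sides of a spot as images (`image_srcI_eq_V₁G`, `card_V₁G_eq_length_lpieces`, …).
Part 2b (`Sd2BlSigningStep`) proves the two semantic identities.
-/

set_option linter.dupNamespace false -- `Summit.PneNP.PneNP.…`: summit = sub-problem name (D-0017 single-conjunct layout)

namespace Summit.PneNP.PneNP.Theorems.Sd2BlMachine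

open Finset Matrix Literature.Computability.Complexity
open Summit.PneNP.PneNP.Theorems.SfmBlMachine
open Summit.PneNP.PneNP.Theorems.CandCutNorm (boolSign)
open Summit.PneNP.PneNP.Theorems.SfmBl (IsConnectedPair sum_part_eq₂ card_part_eq)
open Summit.PneNP.PneNP.Theorems.SignRepCertificate (Cert)
open Summit.PneNP.PneNP.Theorems.SignDeg2Legs (Kind coef CLeg)
open Summit.PneNP.PneNP.Theorems.SignDegCertBridge (certOf certOfIntCert)

variable {k n m : ℕ}

/-! ## The canonical certificate and the instantiated dictionary -/

/-- The canonical degree-2 certificate of an all-sign-degree-≤2 instance (the definiens of `SignDeg2Signing.canonCert`). -/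
noncomputable abbrev cK (I : LocalMap k n m) (h : ∀ j, SignDegLE 2 (I.table j)) : Cert I :=
  certOfIntCert I le_rfl fun j => certOf k 2 (I.table j) (h j)

/-- `gL t` is positive. -/
theorem gL_pos (t : ℕ) : 0 < gL t := by unfold gL; positivity

/-- `plegsK I` is the pieced-leg list of the dictionary's raw legs (by `rfl`). -/
theorem plegsK_eq (I : LocalMap k n m) : plegsK I = pieceLegsG (gL (tK k)) (rawI I (F0k k) (F1k k) (F2k k)) := rfl

/-- Some certificate leg exists when `m ≥ 1` (the certificate of output `0` has margin `2`, so a nonzero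
coefficient). -/
theorem nonempty_CLeg (I : LocalMap k n m) (h : ∀ j, SignDegLE 2 (I.table j)) (hm : 0 < m) :
    Nonempty (CLeg (cK I h)) := by
  classical
  by_contra hE
  rw [not_nonempty_iff] at hE
  have hv := (cK I h).valid ⟨0, hm⟩ (fun _ => false)
  have h0 : ∀ κ : Kind k, coef (cK I h) ⟨0, hm⟩ κ = 0 := by
    intro κ
    by_contra hne'
    have : 0 < (coef (cK I h) ⟨0, hm⟩ κ).natAbs := Int.natAbs_pos.2 hne'
    exact hE.false ⟨⟨0, hm⟩, κ, ⟨0, this⟩⟩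
  have e0 : (cK I h).c0 ⟨0, hm⟩ = 0 := h0 (Sum.inl ())
  have e1 : ∀ i, (cK I h).c1 ⟨0, hm⟩ i = 0 := fun i => h0 (Sum.inr (Sum.inl i))
  have e2 : ∀ i i', (cK I h).c2 ⟨0, hm⟩ i i' = 0 := fun i i' => h0 (Sum.inr (Sum.inr (i, i')))
  simp only [e0, e1, e2, zero_mul, Finset.sum_const_zero, add_zero, mul_zero] at hv
  have hτ : (cK I h).τ = 2 := rfl
  rw [hτ] at hv
  exact absurd hv (by norm_num)

/-- `N ≥ 1` for the machine's data when `m ≥ 1`. -/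
theorem one_le_gN (I : LocalMap k n m) (h : ∀ j, SignDegLE 2 (I.table j)) (hm : 0 < m) : 1 ≤ gN (plegsK I) := by
  classical
  haveI := nonempty_CLeg I h hm
  unfold gN
  rw [plegsK_eq, length_pieces_eq_card_G]
  exact one_le_card_piecesI I (cK I h) (F0k k) (F1k k) (F2k k) (coef_canon_eq_coefF I h) (gL (tK k))

/-! ## The extraction state -/

/-- Every spot has `|V₁ s| + |V₂ s| ≤ t₀'` (it was extracted from a candidate pair of total size `≤ t₀'`, inside which
all its legs run). -/
theorem card_sides_le_pT0' (I : LocalMap k n m) (st : List ℕ × ℕ) (hst : gExtract (ellK k) (tK k) (plegsK I) = st)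
    (hlab : ∀ lab ∈ st.1, lab ≤ st.2) (s : Fin st.2) :
    (V₁G (gL (tK k)) (rawI I (F0k k) (F1k k) (F2k k)) st.1 st.2 hlab s).card
      + (V₂G (gL (tK k)) (rawI I (F0k k) (F1k k) (F2k k)) st.1 st.2 hlab s).card ≤ pT0' (gN (plegsK I)) := by
  subst hst
  have hlen := (gExtract_inv (ellK k) (tK k) (plegsK I)).1
  rw [plegsK_eq, length_pieceLegsG] at hlen
  have hS := spotInv_extract (gRsq (ellK k) (tK k)) (plegsK I) (gCands (tK k) (plegsK I))
    (List.replicate ((plegsK I).length + 1) ())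
  obtain ⟨W, hW, hgeo, _⟩ := hS s.val s.isLt
  obtain ⟨h1, h2⟩ := card_V₁G_le_of_spotInv (gL (tK k)) (rawI I (F0k k) (F1k k) (F2k k)) _ _ hlab hlen s W hgeo
  have hsize : W.1.length + W.2.length ≤ pT0' (gN (plegsK I)) := by
    unfold gCands cands at hW
    rw [List.mem_filter, decide_eq_true_eq] at hW
    exact hW.2
  omega

/-! ## The closer's objects -/

section Objs

variable (I : LocalMap k n m) (h : ∀ j, SignDegLE 2 (I.table j)) (st : List ℕ × ℕ) (hlab : ∀ lab ∈ st.1, lab ≤ st.2)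

/-- The part matrices `M_{p,T}`: `Σ_{e : src e = i, dst e = q, p e = c} χ(T e.out)` over the certificate legs. -/
noncomputable def MpS (T : Fin m → Bool) (cc : Option (Fin st.2)) :
    Matrix (LPieceG (gL (tK k)) (rawI I (F0k k) (F1k k) (F2k k))) (RPieceG (gL (tK k)) (rawI I (F0k k) (F1k k) (F2k k))) ℝ :=
  fun i q => ∑ e ∈ univ.filter (fun e : CLeg (cK I h) =>
      srcI I (cK I h) (F0k k) (F1k k) (F2k k) (coef_canon_eq_coefF I h) (gL (tK k)) e = i ∧
      dstI I (cK I h) (F0k k) (F1k k) (F2k k) (coef_canon_eq_coefF I h) (gL (tK k)) e = q ∧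
      pI I (cK I h) (F0k k) (F1k k) (F2k k) (coef_canon_eq_coefF I h) st.1 st.2 hlab e = cc),
    ((boolSign (T e.out) : ℤ) : ℝ)

open scoped Classical in
/-- The family `𝒲 s`: sub-pairs of the sides of spot `s`, connected through its legs. -/
noncomputable def WS (s : Fin st.2) :
    Finset (Finset (LPieceG (gL (tK k)) (rawI I (F0k k) (F1k k) (F2k k))) × Finset (RPieceG (gL (tK k)) (rawI I (F0k k) (F1k k) (F2k k)))) :=
  ((V₁G (gL (tK k)) (rawI I (F0k k) (F1k k) (F2k k)) st.1 st.2 hlab s).powerset ×ˢ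
    (V₂G (gL (tK k)) (rawI I (F0k k) (F1k k) (F2k k)) st.1 st.2 hlab s).powerset).filter fun W =>
    IsConnectedPair (fun i q => ∃ e : {e : CLeg (cK I h) //
        pI I (cK I h) (F0k k) (F1k k) (F2k k) (coef_canon_eq_coefF I h) st.1 st.2 hlab e = some s},
      srcI I (cK I h) (F0k k) (F1k k) (F2k k) (coef_canon_eq_coefF I h) (gL (tK k)) e.1 = i ∧
      dstI I (cK I h) (F0k k) (F1k k) (F2k k) (coef_canon_eq_coefF I h) (gL (tK k)) e.1 = q) W.1 W.2

open scoped Classical in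
/-- The bad pairs of spot `s` under the signing `T` (threshold `γ_b = √(34ℓ·4^t·2t)`). -/
noncomputable def badS (s : Fin st.2) (T : Fin m → Bool) :
    Finset (Finset (LPieceG (gL (tK k)) (rawI I (F0k k) (F1k k) (F2k k))) × Finset (RPieceG (gL (tK k)) (rawI I (F0k k) (F1k k) (F2k k)))) :=
  (WS I h st hlab s).filter fun W =>
    Real.sqrt (34 * ellK k * (2 : ℝ) ^ (2 * tK k) * (2 * tK k : ℕ)) * Real.sqrt ((W.1.card : ℝ) * (W.2.card : ℝ))
      < |∑ i ∈ W.1, ∑ q ∈ W.2, MpS I h st hlab T (some s) i q|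

/-- `meet_s(W)`: the number of certificate legs of spot `s` meeting the pair. -/
noncomputable def meetS (s : Fin st.2)
    (W : Finset (LPieceG (gL (tK k)) (rawI I (F0k k) (F1k k) (F2k k))) × Finset (RPieceG (gL (tK k)) (rawI I (F0k k) (F1k k) (F2k k)))) : ℝ :=
  ((univ.filter fun e : CLeg (cK I h) =>
      (srcI I (cK I h) (F0k k) (F1k k) (F2k k) (coef_canon_eq_coefF I h) (gL (tK k)) e ∈ W.1 ∨
        dstI I (cK I h) (F0k k) (F1k k) (F2k k) (coef_canon_eq_coefF I h) (gL (tK k)) e ∈ W.2) ∧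
      pI I (cK I h) (F0k k) (F1k k) (F2k k) (coef_canon_eq_coefF I h) st.1 st.2 hlab e = some s).card : ℝ)

/-- Membership in `𝒲 s` (the shape of `h𝒲` of `legBound_of_pipeline`). -/
theorem mem_WS_iff (s : Fin st.2)
    (W : Finset (LPieceG (gL (tK k)) (rawI I (F0k k) (F1k k) (F2k k))) × Finset (RPieceG (gL (tK k)) (rawI I (F0k k) (F1k k) (F2k k)))) :
    W ∈ WS I h st hlab s ↔ W.1 ⊆ V₁G (gL (tK k)) (rawI I (F0k k) (F1k k) (F2k k)) st.1 st.2 hlab s ∧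
      W.2 ⊆ V₂G (gL (tK k)) (rawI I (F0k k) (F1k k) (F2k k)) st.1 st.2 hlab s ∧
      IsConnectedPair (fun i q => ∃ e : {e : CLeg (cK I h) //
          pI I (cK I h) (F0k k) (F1k k) (F2k k) (coef_canon_eq_coefF I h) st.1 st.2 hlab e = some s},
        srcI I (cK I h) (F0k k) (F1k k) (F2k k) (coef_canon_eq_coefF I h) (gL (tK k)) e.1 = i ∧
        dstI I (cK I h) (F0k k) (F1k k) (F2k k) (coef_canon_eq_coefF I h) (gL (tK k)) e.1 = q) W.1 W.2 := by
  unfold WS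
  simp only [mem_filter, mem_product, mem_powerset, and_assoc]

/-- Membership in `bad s T` (the shape of `hbad`). -/
theorem mem_badS_iff (s : Fin st.2) (T : Fin m → Bool)
    (W : Finset (LPieceG (gL (tK k)) (rawI I (F0k k) (F1k k) (F2k k))) × Finset (RPieceG (gL (tK k)) (rawI I (F0k k) (F1k k) (F2k k)))) :
    W ∈ badS I h st hlab s T ↔ W ∈ WS I h st hlab s ∧
      Real.sqrt (34 * ellK k * (2 : ℝ) ^ (2 * tK k) * (2 * tK k : ℕ)) * Real.sqrt ((W.1.card : ℝ) * (W.2.card : ℝ))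
        < |∑ i ∈ W.1, ∑ q ∈ W.2, MpS I h st hlab T (some s) i q| := by
  unfold badS; simp only [mem_filter]

end Objs

/-! ## The sides of a spot as images; their sizes -/

section Sides

variable (I : LocalMap k n m) (h : ∀ j, SignDegLE 2 (I.table j)) (st : List ℕ × ℕ)
  (hst : gExtract (ellK k) (tK k) (plegsK I) = st) (hlab : ∀ lab ∈ st.1, lab ≤ st.2) (s : Fin st.2)

/-- `V₁ s` is the image of the spot's certificate legs under `src`. -/
theorem image_srcI_eq_V₁G :
    (univ.image fun e : {e : CLeg (cK I h) //
        pI I (cK I h) (F0k k) (F1k k) (F2k k) (coef_canon_eq_coefF I h) st.1 st.2 hlab e = some s} =>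
      srcI I (cK I h) (F0k k) (F1k k) (F2k k) (coef_canon_eq_coefF I h) (gL (tK k)) e.1)
      = V₁G (gL (tK k)) (rawI I (F0k k) (F1k k) (F2k k)) st.1 st.2 hlab s := by
  classical
  ext i
  simp only [V₁G, mem_image, mem_filter, mem_univ, true_and]
  constructor
  · rintro ⟨e, rfl⟩; exact ⟨posOf I (cK I h) (F0k k) (F1k k) (F2k k) (coef_canon_eq_coefF I h) e.1, e.2, rfl⟩
  · rintro ⟨p, hp, rfl⟩
    obtain ⟨e, rfl⟩ := posOf_surjective I (cK I h) (F0k k) (F1k k) (F2k k) (coef_canon_eq_coefF I h) p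
    exact ⟨⟨e, hp⟩, rfl⟩

/-- `V₂ s` is the image of the spot's certificate legs under `dst`. -/
theorem image_dstI_eq_V₂G :
    (univ.image fun e : {e : CLeg (cK I h) //
        pI I (cK I h) (F0k k) (F1k k) (F2k k) (coef_canon_eq_coefF I h) st.1 st.2 hlab e = some s} =>
      dstI I (cK I h) (F0k k) (F1k k) (F2k k) (coef_canon_eq_coefF I h) (gL (tK k)) e.1)
      = V₂G (gL (tK k)) (rawI I (F0k k) (F1k k) (F2k k)) st.1 st.2 hlab s := by
  classical
  ext i
  simp only [V₂G, mem_image, mem_filter, mem_univ, true_and]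
  constructor
  · rintro ⟨e, rfl⟩; exact ⟨posOf I (cK I h) (F0k k) (F1k k) (F2k k) (coef_canon_eq_coefF I h) e.1, e.2, rfl⟩
  · rintro ⟨p, hp, rfl⟩
    obtain ⟨e, rfl⟩ := posOf_surjective I (cK I h) (F0k k) (F1k k) (F2k k) (coef_canon_eq_coefF I h) p
    exact ⟨⟨e, hp⟩, rfl⟩

include hst in
/-- The machine's spot leg list lists the spot's certificate legs. -/
theorem mem_slegsK_iff (x : PLeg) : x ∈ slegs (plegsK I) st.1 s.val ↔
    ∃ e : {e : CLeg (cK I h) // pI I (cK I h) (F0k k) (F1k k) (F2k k) (coef_canon_eq_coefF I h) st.1 st.2 hlab e = some s},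
      plegI I (cK I h) (F0k k) (F1k k) (F2k k) (coef_canon_eq_coefF I h) (gL (tK k)) e.1 = x := by
  have hlen := (gExtract_inv (ellK k) (tK k) (plegsK I)).1
  rw [hst, plegsK_eq, length_pieceLegsG] at hlen
  rw [plegsK_eq]
  exact mem_slegs_iff_subtypeI I (cK I h) (F0k k) (F1k k) (F2k k) (coef_canon_eq_coefF I h) (gL (tK k)) hlab hlen s x

include h hst in
/-- `|V₁ s| = #left pieces of the machine's legs of spot s`. -/
theorem card_V₁G_eq_length_lpieces :
    (V₁G (gL (tK k)) (rawI I (F0k k) (F1k k) (F2k k)) st.1 st.2 hlab s).card = (lpieces (slegs (plegsK I) st.1 s.val)).length := by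
  classical
  rw [← image_srcI_eq_V₁G I h st hlab s]
  unfold lpieces
  rw [← List.card_toFinset, ← Finset.card_image_of_injective _ Subtype.val_injective]
  congr 1
  ext P
  simp only [Finset.mem_image, mem_univ, true_and, List.mem_toFinset, List.mem_map]
  constructor
  · rintro ⟨_, ⟨e, rfl⟩, rfl⟩
    exact ⟨_, (mem_slegsK_iff I h st hst hlab s _).2 ⟨e, rfl⟩, rfl⟩
  · rintro ⟨x, hx, rfl⟩
    obtain ⟨e, rfl⟩ := (mem_slegsK_iff I h st hst hlab s x).1 hx
    exact ⟨_, ⟨e, rfl⟩, rfl⟩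

include h hst in
/-- `|V₂ s| = #right pieces of the machine's legs of spot s`. -/
theorem card_V₂G_eq_length_rpieces :
    (V₂G (gL (tK k)) (rawI I (F0k k) (F1k k) (F2k k)) st.1 st.2 hlab s).card = (rpieces (slegs (plegsK I) st.1 s.val)).length := by
  classical
  rw [← image_dstI_eq_V₂G I h st hlab s]
  unfold rpieces
  rw [← List.card_toFinset, ← Finset.card_image_of_injective _ Subtype.val_injective]
  congr 1
  ext P
  simp only [Finset.mem_image, mem_univ, true_and, List.mem_toFinset, List.mem_map]
  constructor
  · rintro ⟨_, ⟨e, rfl⟩, rfl⟩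
    exact ⟨_, (mem_slegsK_iff I h st hst hlab s _).2 ⟨e, rfl⟩, rfl⟩
  · rintro ⟨x, hx, rfl⟩
    obtain ⟨e, rfl⟩ := (mem_slegsK_iff I h st hst hlab s x).1 hx
    exact ⟨_, ⟨e, rfl⟩, rfl⟩

end Sides


end Summit.PneNP.PneNP.Theorems.Sd2BlMachine
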